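import Summits.AnomalousDissipation.AnomalousDissipation.Theorems.ImpulseGridGridSignsCoherentTransfer
import Literature.Analysis.FunctionSpaces.TorusFourierCalculus

/-!
# Route ImpulseGrid (AnomalousDissipation) — coherent loud wakes give `GridThesis` directly

Companion of `Theorems/ImpulseGridGridSignsCoherentTransfer.lean` (crux `GridSigns`, line `Sketch`,
card `coherent-grid-wakes-period-averages`): the SAME hypothesis — a slab⊗transverse design and a
vanishing-viscosity family of time-periodic classical wakes with drift `c`, energy bounded uniformly
in `j, t`, nonnegative period-mean resonant work and a period-mean dissipation excess `≥ η` — gives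
the route TARGET `GridThesis` (stmt-AnomalousDissipation-1770) outright, i.e. also its two extra
clauses: the per-`j` sup-in-time energy bound (pointwise from the uniform `L²` bound) and the
no-leakage clause `⟨(Φ•G,u_j)⟩ ≤ meanDissipation`, which holds with EQUALITY along a periodic
classical wake (period energy balance `∫₀^τ(Φ•G,u) = ν∫₀^τ‖∇u‖²`, the spectral dissipation of a
smooth slice being the classical one, `Torus.eGradNormSq_eq_ofReal_gradNormSq`, and both long-time
`limsup` means being period means, `longTimeAvgSup_eq_of_periodic`). So promoting the single open
stub of line `Sketch` to an item would give a one-item proof path to the target, bypassing both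
proof-path children `GridSignsLaw` / `BoundedEnergyNoLeakGrid`. No new definitions.
-/

noncomputable section

-- `Summit.<Summit>.<Problem>` is the tree's mandated summit-side namespace (CONVENTIONS §2); for this
-- single-conjunct summit the two coincide, so the duplicate is deliberate.
set_option linter.dupNamespace false

open MeasureTheory Set Filter Topology
open scoped InnerProductSpace RealInnerProductSpace

namespace Summit.AnomalousDissipation.AnomalousDissipation.Theorems.ImpulseGridGridSigns

open Literature.Analysis
open Literature.Analysis.FluidPDE
open Literature.Analysis.FunctionSpaces Literature.Analysis.FunctionSpaces.Torus
open Summit.AnomalousDissipation.AnomalousDissipation.Theses.ImpulseGrid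

section Transfer

variable {Φ Ψ : UnitAddTorus (Fin 3) → ℝ} {G : UnitAddTorus (Fin 3) → EuclideanSpace ℝ (Fin 3)}
  {ν τ : ℝ} {u : ℝ → UnitAddTorus (Fin 3) → EuclideanSpace ℝ (Fin 3)}
  {p : ℝ → UnitAddTorus (Fin 3) → ℝ}

/-- Along a classical solution on all of `ℝ` the spectral dissipation integrand of
`meanDissipation` is the classical one: `ν·(eGradNormSq (u t)).toReal = ν·‖∇u(t)‖₂²` for every `t`
(`Torus.eGradNormSq_eq_ofReal_gradNormSq` on the smooth slice `u t`). [folklore] -/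
theorem dissipation_integrand_eq
    (h : FunctionSpaces.Torus.IsClassicalNSSolutionOn Set.univ ν (fun _ => fun x => Φ x • G x) u p) :
    (fun t => ν * (eGradNormSq (u t)).toReal) = fun t => ν * gradNormSq (u t) := by
  funext t
  rw [eGradNormSq_eq_ofReal_gradNormSq (h.smooth_velocity.isSmooth_slice (mem_univ t)),
    ENNReal.toReal_ofReal (gradNormSq_nonneg _)]

/-- **No leakage along a periodic classical wake** (with equality): the `limsup` long-time mean of
the injected power equals the mean dissipation,
`longTimeAvgSup (Φ•G,u) = τ⁻¹ν∫₀^τ‖∇u‖₂² = meanDissipation ν u`. [folklore] -/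
theorem longTimeAvgSup_work_eq_meanDissipation
    (h : FunctionSpaces.Torus.IsClassicalNSSolutionOn Set.univ ν (fun _ => fun x => Φ x • G x) u p)
    (hper : Function.Periodic u τ) (hτ : 0 < τ) :
    longTimeAvgSup (fun t => ∫ x, ⟪Φ x • G x, u t x⟫) = meanDissipation ν u := by
  rw [meanDissipation, dissipation_integrand_eq h,
    longTimeAvgSup_eq_of_periodic (periodic_comp hper fun v => ∫ x, ⟪Φ x • G x, v x⟫) hτ,
    longTimeAvgSup_eq_of_periodic (periodic_comp hper fun v => ν * gradNormSq v) hτ,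
    intervalIntegral.integral_const_mul, period_work_eq_dissipation h hper hτ]

/-- **Coherent loud wakes give the target `GridThesis`** (stmt-AnomalousDissipation-1770): as in
`gridSigns_of_coherentWakes`, plus the per-`j` sup-energy clause (pointwise from the uniform `L²`
bound) and the no-leakage clause (`longTimeAvgSup_work_eq_meanDissipation`). [folklore] -/
theorem gridThesis_of_coherentWakes :
    (∃ (Φ Ψ : UnitAddTorus (Fin 3) → ℝ) (G : UnitAddTorus (Fin 3) → EuclideanSpace ℝ (Fin 3)) (c η : ℝ),
      IsSmooth Φ ∧ IsSmooth Ψ ∧ IsSmooth G ∧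
      (∀ (s : UnitAddCircle) x, Ψ (x + Pi.single (1 : Fin 3) s) = Ψ x ∧ Ψ (x + Pi.single (2 : Fin 3) s) = Ψ x) ∧
      (∀ (s : UnitAddCircle) x, G (x + Pi.single (0 : Fin 3) s) = G x) ∧ (∀ x, G x 0 = 0) ∧ IsDivFree G ∧
      (∀ x, Torus.partialDeriv 0 Ψ x = Φ x - 1) ∧ (∫ x, Φ x * Ψ x * ‖G x‖ ^ 2 = 0) ∧
      IsSmooth (fun x => Φ x • G x) ∧ IsDivFree (fun x => Φ x • G x) ∧ HasZeroMean (fun x => Φ x • G x) ∧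
      0 < c ∧ 0 < η ∧
      ∃ (ν τ : ℕ → ℝ) (u : ℕ → ℝ → UnitAddTorus (Fin 3) → EuclideanSpace ℝ (Fin 3))
        (p : ℕ → ℝ → UnitAddTorus (Fin 3) → ℝ),
        (∀ j, 0 < ν j) ∧ Tendsto ν atTop (nhds 0) ∧
        (∀ j, FunctionSpaces.Torus.IsClassicalNSSolutionOn Set.univ (ν j) (fun _ => fun x => Φ x • G x) (u j) (p j) ∧
          0 < τ j ∧ Function.Periodic (u j) (τ j)) ∧
        (∀ j, ∫ x, u j 0 x = c • EuclideanSpace.single 0 1) ∧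
        (∃ E : ℝ, ∀ j t, ∫ x, ‖u j t x‖ ^ 2 ≤ E) ∧
        (∀ j, 0 ≤ ∫ t in (0 : ℝ)..τ j, ∫ x, ⟪G x, u j t x⟫) ∧
        (∀ j, τ j * η ≤ c * (∫ t in (0 : ℝ)..τ j, (ν j * gradNormSq (u j t) - ∫ x, ⟪G x, u j t x⟫))
            + ν j * (∫ t in (0 : ℝ)..τ j, ∫ x, ⟪u j t x, Torus.laplacian (fun y => Ψ y • G y) x⟫))) →
    GridThesis := by
  intro hC
  -- `GridSigns` for the same data, to copy its mean-energy and sign clauses is not possible (the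
  -- witnesses are existential), so the bookkeeping of `gridSigns_of_coherentWakes` is repeated.
  obtain ⟨Φ, Ψ, G, c, η, hΦ, hΨ, hG, hΨinv, hGinv, hG0, hGdiv, hΨ', hnorm, hf1, hf2, hf3, hc, hη,
    ν, τ, u, p, hν, hν0, hsol, hmom, ⟨E, hE⟩, ha, hb⟩ := hC
  obtain ⟨Λ⟩ := (GeneralizedLimit.nonempty_holds : Nonempty GeneralizedLimit)
  have hLH : ∀ j, FluidPDE.Torus.IsGlobalLerayHopf (ν j) (fun _ => fun x => Φ x • G x) (u j 0) (u j) :=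
    fun j => (hsol j).1.isGlobalLerayHopf
  have hsup : ∀ j, ∃ C : ℝ, ∀ t : ℝ, 0 ≤ t → kineticEnergy (u j t) ≤ C := fun j =>
    ⟨2⁻¹ * E, fun t _ => by
      unfold kineticEnergy
      exact mul_le_mul_of_nonneg_left (hE j t) (by norm_num)⟩
  refine ⟨Φ, Ψ, G, c, η, Λ, hΦ, hΨ, hG, hΨinv, hGinv, hG0, hGdiv, hΨ', hnorm, hf1, hf2, hf3, hc, hη,
    ν, fun j => u j 0, u, hν, hν0, hLH, hsup, hmom, ⟨E, fun j => ?_⟩, fun j => ?_, fun j => ?_,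
    fun j => ?_⟩
  · -- mean energy
    obtain ⟨hcl, hτ, hper⟩ := hsol j
    rw [meanEnergy_eq_longTimeAvgSup,
      longTimeAvgSup_eq_of_periodic (periodic_comp hper fun v => ∫ x, ‖v x‖ ^ 2) hτ]
    have hbound : ‖∫ t in (0 : ℝ)..τ j, ∫ x, ‖u j t x‖ ^ 2‖ ≤ E * |τ j - 0| := by
      refine intervalIntegral.norm_integral_le_of_norm_le_const fun t _ => ?_
      rw [Real.norm_of_nonneg (integral_nonneg fun x => sq_nonneg _)]
      exact hE j t
    rw [sub_zero, abs_of_pos hτ] at hbound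
    calc (τ j)⁻¹ * ∫ t in (0 : ℝ)..τ j, ∫ x, ‖u j t x‖ ^ 2
        ≤ (τ j)⁻¹ * (E * τ j) :=
          mul_le_mul_of_nonneg_left ((le_abs_self _).trans hbound) (inv_nonneg.2 hτ.le)
      _ = E := by field_simp
  · -- no leakage (equality along a periodic classical wake)
    obtain ⟨hcl, hτ, hper⟩ := hsol j
    exact (longTimeAvgSup_work_eq_meanDissipation hcl hper hτ).le
  · -- (a) no reversal
    obtain ⟨hcl, hτ, hper⟩ := hsol j
    rw [longTimeAvg_eq_periodMean Λ hper hτ fun v => ∫ x, ⟪G x, v x⟫]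
    exact mul_nonneg (inv_nonneg.2 hτ.le) (ha j)
  · -- (b) early relaxation
    obtain ⟨hcl, hτ, hper⟩ := hsol j
    have hI := (impulseGrid_gridInjectionIdentity Λ (ν j) c Φ Ψ G (u j 0) (u j) (hν j) hΦ hΨ hG hΨinv
      hGinv hG0 hGdiv hΨ' (hLH j) (hsup j)).1
    rw [hnorm] at hI
    have hA : Λ.longTimeAvg (fun t => ∫ x, ⟪G x, u j t x⟫) = (τ j)⁻¹ * ∫ t in (0 : ℝ)..τ j, ∫ x, ⟪G x, u j t x⟫ :=
      longTimeAvg_eq_periodMean Λ hper hτ fun v => ∫ x, ⟪G x, v x⟫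
    have hF : Λ.longTimeAvg (fun t => ∫ x, ⟪Φ x • G x, u j t x⟫) =
        (τ j)⁻¹ * (ν j * ∫ t in (0 : ℝ)..τ j, gradNormSq (u j t)) := by
      rw [longTimeAvg_eq_periodMean Λ hper hτ fun v => ∫ x, ⟪Φ x • G x, v x⟫,
        period_work_eq_dissipation hcl hper hτ]
    have hL : Λ.longTimeAvg (fun t => ∫ x, ⟪u j t x, Torus.laplacian (fun y => Ψ y • G y) x⟫) =
        (τ j)⁻¹ * ∫ t in (0 : ℝ)..τ j, ∫ x, ⟪u j t x, Torus.laplacian (fun y => Ψ y • G y) x⟫ :=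
      longTimeAvg_eq_periodMean Λ hper hτ fun v => ∫ x, ⟪v x, Torus.laplacian (fun y => Ψ y • G y) x⟫
    have iD : IntervalIntegrable (fun t => ν j * gradNormSq (u j t)) volume 0 (τ j) :=
      ((continuous_gradNormSq hcl).continuousOn.intervalIntegrable).const_mul (ν j)
    have iA : IntervalIntegrable (fun t => ∫ x, ⟪G x, u j t x⟫) volume 0 (τ j) :=
      (continuous_integral_inner_const hcl hG).continuousOn.intervalIntegrable
    have hbj := hb j
    rw [intervalIntegral.integral_sub iD iA, intervalIntegral.integral_const_mul] at hbj
    set A := ∫ t in (0 : ℝ)..τ j, ∫ x, ⟪G x, u j t x⟫ with hAdef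
    set D := ∫ t in (0 : ℝ)..τ j, gradNormSq (u j t) with hDdef
    set L := ∫ t in (0 : ℝ)..τ j, ∫ x, ⟪u j t x, Torus.laplacian (fun y => Ψ y • G y) x⟫ with hLdef
    have hτinv : 0 < (τ j)⁻¹ := inv_pos.2 hτ
    have key : Λ.longTimeAvg (fun t => ∫ x, ⟪u j t x - c • EuclideanSpace.single 0 1,
        Torus.convect (fun y => u j t y - c • EuclideanSpace.single 0 1) (fun y => Ψ y • G y) x⟫) =
        -((τ j)⁻¹ * (c * (ν j * D - A) + ν j * L)) := by
      rw [hA, hF, hL] at hI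
      linear_combination hI
    rw [key, neg_le_neg_iff]
    calc η = (τ j)⁻¹ * (τ j * η) := by field_simp
      _ ≤ (τ j)⁻¹ * (c * (ν j * D - A) + ν j * L) := mul_le_mul_of_nonneg_left hbj hτinv.le

end Transfer

end Summit.AnomalousDissipation.AnomalousDissipation.Theorems.ImpulseGridGridSigns

end
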